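import Summits.HubbardSuperconductivity.HubbardSuperconductivity.Theses.BalabanIR
import Summits.HubbardSuperconductivity.HubbardSuperconductivity.Theorems.LogColdTorusAverageToEveryRecut
import Summits.HubbardSuperconductivity.HubbardSuperconductivity.Theorems.BalabanIRBirEveryGroundStateSectorPBHubbard
import Summits.HubbardSuperconductivity.HubbardSuperconductivity.Theorems.BalabanIRBirEveryGroundStateSocket
import Literature.MathematicalPhysics.QuantumLattice.FinDimSpectrumSectorGibbsLimit
import Literature.MathematicalPhysics.QuantumLattice.FinDimSpectrum
import Literature.MathematicalPhysics.QuantumLattice.TransferOperatorDual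
import HarnessLib

/-!
# Route `BalabanIR`, crux 5 `BirEveryGroundState` (item `stmt-HubbardSuperconductivity-2083`):
both conjugate-source RE-CUT targets are EQUIVALENT TO THE SUMMIT

Helpers (`--supports stmt-HubbardSuperconductivity-2083`); plan-level certificates (D-0014) for the
decision pending on crux 5 ("hold or re-cut", `Cruxes/BirEveryGroundState/STRATEGY-CENSUS.md`
Part B §8, whose door is the ROUTE-LEVEL re-cut through the conjugate source `κ L⁻⁴ Δ_d† Δ_d`).
The two re-cut targets proposed there are, written out,

* `X'_avg` (`BirShiftedAverageLRO` of the census sketch) — verbatim the hypothesis of the landed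
  closer `Theorems.shiftedAverageSummit`: at ONE `(δ, U)`, eventually in even `L`, for SOME `κ > 0`
  per side, the ground-state AVERAGE of `Δ_d† Δ_d` over the sector ground eigenspace of the
  PENALISED `hubbardTorus 2 L 1 U + κ L⁻⁴ Δ_d† Δ_d` is `≥ c L⁴`;
* `X'_th` (`BirPenalisedThermalLRO`) — verbatim the hypothesis of the landed closer
  `Theorems.penalisedThermalAverageSummit`: at ONE `(δ, U)`, eventually in even `L`, for SOME
  `κ, β > 0` per side, `a + L² log 4 / (βκ) ≤ ⟨L⁻⁴ Δ_d† Δ_d⟩_{β,κ}` (sector Gibbs average in the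
  κ-penalised canonical ensemble).

This file proves that BOTH are `Iff`-equivalent to `HubbardSuperconductivity` itself:

* `hubbardSuperconductivity_iff_shiftedAverage : HubbardSuperconductivity ↔ X'_avg`;
* `exists_penalisedThermalAverage_of_forall_groundState_bound` — per side, an every-ground-state
  floor `a L⁴` gives `κ, β > 0` with `a/16 + L² log 4 / (βκ) ≤ ⟨L⁻⁴ Δ_d† Δ_d⟩_{β,κ}` (the shifted
  average of `exists_shiftedAverage_of_forall_groundState_bound`, then the zero-temperature limit
  of the sector Gibbs state of the penalised Hamiltonian, `tendsto_sectorGibbsAverage_atTop`);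
* `hubbardSuperconductivity_iff_penalisedThermalAverage : HubbardSuperconductivity ↔ X'_th`;
* route corollaries: `X_avg → crux 5 → X'_avg` / `→ X'_th` (the re-cut target is implied by the
  pair it replaces) and `4R → crux 5 → 4RS` (the re-typed reduction is implied by the present one
  plus crux 5; conversely `4RS` closes the route alone by the landed closer — the census's
  `closes_recut`).

Reading for the planner: the conjugate-source door does not manufacture an intermediate statement
strictly between the engine output and the summit — `X'_avg` and `X'_th` ARE the summit in
penalised dress (summit-equivalent items in the sense of the ledger), so after the re-cut the whole
content of the route sits in the re-typed reduction `4RS`/`4RT` (engine ⇒ summit-in-shifted-form);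
crux 5 disappears because its content moves into the reduction, not because it is discharged.
What the dress buys is real but lives on the ENGINE side: a ground-state or finite-`β` AVERAGE with
the conjugate source switched on is trace currency (what a functional-integral engine computes),
and "every ground state" then costs nothing (Griffiths).

Sources: R. B. Griffiths, J. Math. Phys. 5 (1964) 1215 §III; T. Kato, *Perturbation Theory for
Linear Operators* (1966) §II.5; H. Tasaki, *Physics and Mathematics of Quantum Many-Body Systems*
(2020) §2.2, App. A.2; B. Simon, *The Statistical Mechanics of Lattice Gases* I (1993) §II.13;
D. J. Scalapino, Phys. Rep. 250 (1995) 329 §2. Folklore bookkeeping over landed theorems; no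
definition and no named fact is introduced.

## Mathlib / tree search

REUSED: `Theorems.hubbardSuperconductivity_of_shiftedAverage`, `penalisedGroundEigenspace_ne_bot`
(`…SourceShift`), `Theorems.hubbardSuperconductivity_of_penalisedThermalAverage` (`…SectorPBHubbard`),
`Theorems.forall_hasLRO_iff_groundState_bound` (`…Socket`),
`Theorems.exists_shiftedAverage_of_forall_groundState_bound` (`LogColdTorusAverageToEveryRecut`),
`Literature…tendsto_sectorGibbsAverage_atTop`, `trace_projMatrix_map_eq_finrank`
(`FinDimSpectrumSectorGibbsLimit`), `isHermitian_gibbsWeight` (`FinDimSpectrum`),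
`im_trace_mul_of_isHermitian` (`TransferOperatorDual`), `map_toEuclidean_eq` (`…Bounds`),
`szSector_invariant_hubbardTorus`, `pairIntensity_mulVec_mem_szSector`, `Theses.BalabanIR.closes`,
`Assembly_holds`. `lean search 'iff_shifted|shiftedAverage_iff|_of_hubbardSuperconductivity'`:
no converse of either closer existed before `LogColdTorusAverageToEveryRecut` (2026-08-17).
-/

noncomputable section

-- `dupNamespace`: the summit and the problem are both named `HubbardSuperconductivity` (layout D-0022)
set_option linter.dupNamespace false

namespace Summit.HubbardSuperconductivity.HubbardSuperconductivity.Theorems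

open Matrix Finset Filter Topology
open Literature.Probability.LatticeModels Literature.MathematicalPhysics.QuantumLattice
open scoped ComplexOrder Matrix Classical

section Hubbard

/-- `re (z / d) = re z / re d` for a real denominator `d` (`im d = 0`). [folklore] -/
theorem re_div_of_im_eq_zero (z d : ℂ) (hd : d.im = 0) : (z / d).re = z.re / d.re := by
  have h : d = ((d.re : ℝ) : ℂ) := Complex.ext (by simp) (by simp [hd])
  conv_lhs => rw [h]
  exact Complex.div_ofReal_re z d.re

/-- **Zero-temperature ground-state bound ⇒ the penalised THERMAL average, per side.** On the
`L × L` Hubbard torus (`H = hubbardTorus 2 L 1 U`, sector `S = (2⌊(1-δ)L²/2⌋, S^z = 0)`,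
`δ ≥ -1`): if every normalised sector ground state `ψ` of `H` has `a L⁴ ≤ re ⟨ψ, Δ_d† Δ_d ψ⟩`
(`a > 0`), then for some `κ, β > 0` the sector Gibbs average of `Y_L = L⁻⁴ Δ_d† Δ_d` in the canonical
ensemble of the PENALISED `H + κ Y_L` satisfies `a/16 + L² log 4 / (βκ) ≤ ⟨Y_L⟩_{β,κ}` — verbatim
the per-side matrix consumed by `hubbardSuperconductivity_of_penalisedThermalAverage`. Proof: the
shifted ground-state average `≥ (a/4) L⁴` at a small `κ > 0`
(`exists_shiftedAverage_of_forall_groundState_bound`); the sector Gibbs average of `Y_L` under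
`H + κ Y_L` tends, as `β → ∞`, to its average over the sector ground eigenspace of `H + κ Y_L`
(`tendsto_sectorGibbsAverage_atTop`), which is `≥ a/4`; so for `β` large it exceeds `a/8`, while
`L² log 4 / (βκ) ≤ a/16`. Tasaki (2020) §2.2, App. A.2; Simon (1993) §II.13; Griffiths (1964)
§III. [folklore] -/
theorem exists_penalisedThermalAverage_of_forall_groundState_bound (L : ℕ) [NeZero L]
    (U δ a : ℝ) (hδ : -1 ≤ δ) (ha : 0 < a)
    (hGS : ∀ ψ : Fock (Orb (FermionTorus 2 L)),
      IsGroundStateInSector (hubbardTorus 2 L 1 U) (2 * ⌊(1 - δ) * (L : ℝ) ^ 2 / 2⌋₊) 0 ψ →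
      star ψ ⬝ᵥ ψ = 1 →
      a * (L : ℝ) ^ 4 ≤
        (star ψ ⬝ᵥ ((pairField dWaveFormFactor L)ᴴ * pairField dWaveFormFactor L) *ᵥ ψ).re) :
    ∃ κ β : ℝ, 0 < κ ∧ 0 < β ∧
      let N : ℕ := 2 * ⌊(1 - δ) * (L : ℝ) ^ 2 / 2⌋₊
      let H := hubbardTorus 2 L 1 U
      let S := szSector (Λ := FermionTorus 2 L) N 0
      let PS := projMatrix (S.map (Fock.toEuclidean (ι := Orb (FermionTorus 2 L)) :
        Fock (Orb (FermionTorus 2 L)) →ₗ[ℂ] EuclideanSpace ℂ (Finset (Orb (FermionTorus 2 L)))))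
      let Yd : Matrix (Finset (Orb (FermionTorus 2 L))) (Finset (Orb (FermionTorus 2 L))) ℂ :=
        ((1 : ℂ) / (L : ℂ) ^ 4) • ((pairField dWaveFormFactor L)ᴴ * pairField dWaveFormFactor L)
      a / 16 + (L : ℝ) ^ 2 * Real.log 4 / (β * κ) ≤
        (PS * gibbsWeight β (H + (κ : ℂ) • Yd) * Yd).trace.re /
          (PS * gibbsWeight β (H + (κ : ℂ) • Yd)).trace.re := by
  obtain ⟨κ, hκ, hshift⟩ := exists_shiftedAverage_of_forall_groundState_bound L U δ a ha hGS
  have hE := penalisedGroundEigenspace_ne_bot L U δ hδ κ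
  simp only at hshift hE ⊢
  -- abbreviations (all `let`s of the statement are now unfolded)
  set A : Matrix (Finset (Orb (FermionTorus 2 L))) (Finset (Orb (FermionTorus 2 L))) ℂ :=
    (pairField dWaveFormFactor L)ᴴ * pairField dWaveFormFactor L with hA
  set H : Matrix (Finset (Orb (FermionTorus 2 L))) (Finset (Orb (FermionTorus 2 L))) ℂ :=
    hubbardTorus 2 L 1 U with hH
  set S : Submodule ℂ (Fock (Orb (FermionTorus 2 L))) :=
    szSector (Λ := FermionTorus 2 L) (2 * ⌊(1 - δ) * (L : ℝ) ^ 2 / 2⌋₊) 0 with hS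
  set Yd : Matrix (Finset (Orb (FermionTorus 2 L))) (Finset (Orb (FermionTorus 2 L))) ℂ :=
    ((1 : ℂ) / (L : ℂ) ^ 4) • A with hYd
  set X : Matrix (Finset (Orb (FermionTorus 2 L))) (Finset (Orb (FermionTorus 2 L))) ℂ :=
    H + (κ : ℂ) • Yd with hX
  set E : Submodule ℂ (Fock (Orb (FermionTorus 2 L))) :=
    S ⊓ Module.End.eigenspace (Matrix.toLin' X) (((X.minEnergyOn S : ℝ)) : ℂ) with hEdef
  -- Hermitian data and invariance of the sector under the penalised Hamiltonian
  have hHh : H.IsHermitian := LiebThm1.hamiltonian_isHermitian (fermionTorusGraph 2 L) 1 U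
  have hAh : A.IsHermitian := isHermitian_conjTranspose_mul_self _
  have hYdh : Yd.IsHermitian := by
    refine hAh.smul ?_
    rw [isSelfAdjoint_iff, Complex.star_def, map_div₀, map_one, map_pow, Complex.conj_natCast]
  have hXh : X.IsHermitian :=
    hHh.add (hYdh.smul (by rw [isSelfAdjoint_iff, Complex.star_def, Complex.conj_ofReal]))
  have hinvX : ∀ v ∈ S, X *ᵥ v ∈ S := by
    intro v hv
    rw [hX, add_mulVec, smul_mulVec, hYd, smul_mulVec]
    exact S.add_mem (szSector_invariant_hubbardTorus 2 L 1 U _ hv)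
      (S.smul_mem _ (S.smul_mem _ (pairIntensity_mulVec_mem_szSector L _ hv)))
  -- the zero-temperature limit of the sector Gibbs average of `Yd` under `X`
  have hlim := tendsto_sectorGibbsAverage_atTop hXh S hinvX hE Yd
  rw [← map_toEuclidean_eq, ← map_toEuclidean_eq] at hlim
  set PE := projMatrix (E.map (Fock.toEuclidean (ι := Orb (FermionTorus 2 L)) :
    Fock (Orb (FermionTorus 2 L)) →ₗ[ℂ] EuclideanSpace ℂ (Finset (Orb (FermionTorus 2 L)))))
    with hPE
  set PS := projMatrix (S.map (Fock.toEuclidean (ι := Orb (FermionTorus 2 L)) :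
    Fock (Orb (FermionTorus 2 L)) →ₗ[ℂ] EuclideanSpace ℂ (Finset (Orb (FermionTorus 2 L)))))
    with hPS
  -- the limit value has real part `≥ a/4`
  have hL : (0 : ℝ) < (L : ℝ) := by exact_mod_cast Nat.pos_of_ne_zero (NeZero.ne L)
  have hL4 : (0 : ℝ) < (L : ℝ) ^ 4 := by positivity
  have htrPE : PE.trace = (Module.finrank ℂ E : ℂ) := by
    rw [hPE, map_toEuclidean_eq]
    exact trace_projMatrix_map_eq_finrank E
  have hm : (0 : ℝ) < (Module.finrank ℂ E : ℝ) := by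
    exact_mod_cast Nat.cast_pos.mpr (Submodule.one_le_finrank_iff.mpr hE)
  have htrPEre : PE.trace.re = (Module.finrank ℂ E : ℝ) := by
    rw [htrPE, Complex.natCast_re]
  have hYdA : (PE * Yd).trace = (((1 / (L : ℝ) ^ 4 : ℝ)) : ℂ) * (PE * A).trace := by
    rw [hYd, Matrix.mul_smul, trace_smul, smul_eq_mul]
    push_cast
    ring
  have hlimre : a / 4 ≤ ((PE * Yd).trace / PE.trace).re := by
    rw [htrPE, Complex.div_natCast_re, hYdA, Complex.re_ofReal_mul, le_div_iff₀ hm]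
    rw [htrPEre] at hshift
    -- `hshift : a / 4 * L⁴ * m ≤ re tr (PE A)`
    have key : a / 4 * (Module.finrank ℂ E : ℝ) * (L : ℝ) ^ 4 ≤ (PE * A).trace.re := by
      nlinarith [hshift]
    calc a / 4 * (Module.finrank ℂ E : ℝ)
        = 1 / (L : ℝ) ^ 4 * (a / 4 * (Module.finrank ℂ E : ℝ) * (L : ℝ) ^ 4) := by
          field_simp
      _ ≤ 1 / (L : ℝ) ^ 4 * (PE * A).trace.re :=
          mul_le_mul_of_nonneg_left key (by positivity)
  -- eventually in `β`: the Gibbs average exceeds `a/8`, and the entropy term is `≤ a/16`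
  have hre : Tendsto (fun β : ℝ => ((PS * gibbsWeight β X * Yd).trace /
      (PS * gibbsWeight β X).trace).re) atTop (𝓝 ((PE * Yd).trace / PE.trace).re) :=
    (Complex.continuous_re.tendsto _).comp hlim
  have h1 : ∀ᶠ β : ℝ in atTop, a / 8 < ((PS * gibbsWeight β X * Yd).trace /
      (PS * gibbsWeight β X).trace).re :=
    hre.eventually_const_lt (by linarith)
  set β₁ : ℝ := 16 * ((L : ℝ) ^ 2 * Real.log 4) / (κ * a) with hβ₁
  have h2 : ∀ᶠ β : ℝ in atTop, β₁ ≤ β := eventually_ge_atTop β₁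
  have h3 : ∀ᶠ β : ℝ in atTop, (1 : ℝ) ≤ β := eventually_ge_atTop 1
  obtain ⟨β, hβ1, hβ2, hβ3⟩ := (h1.and (h2.and h3)).exists
  have hβ : 0 < β := by linarith
  refine ⟨κ, β, hκ, hβ, ?_⟩
  -- the denominator is real, so `re (num / den) = re num / re den`
  have hden : (PS * gibbsWeight β X).trace.im = 0 :=
    im_trace_mul_of_isHermitian (projMatrix_isHermitian _) (isHermitian_gibbsWeight β hXh)
  have hratio : ((PS * gibbsWeight β X * Yd).trace / (PS * gibbsWeight β X).trace).re =
      (PS * gibbsWeight β X * Yd).trace.re / (PS * gibbsWeight β X).trace.re :=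
    re_div_of_im_eq_zero _ _ hden
  -- the entropy budget
  have hlog4 : 0 < Real.log 4 := Real.log_pos (by norm_num)
  have hent : (L : ℝ) ^ 2 * Real.log 4 / (β * κ) ≤ a / 16 := by
    rw [div_le_iff₀ (mul_pos hβ hκ)]
    have : 16 * ((L : ℝ) ^ 2 * Real.log 4) ≤ β * (κ * a) := by
      rw [hβ₁, div_le_iff₀ (mul_pos hκ ha)] at hβ2
      exact hβ2
    nlinarith [this]
  rw [← hratio]
  linarith [hβ1, hent]

/-- **`HubbardSuperconductivity ↔ X'_avg` — the conjugate-source re-cut target is the summit.**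
The right-hand side is VERBATIM the hypothesis of the landed closer `shiftedAverageSummit`
(= `BirShiftedAverageLRO` of `Cruxes/BirEveryGroundState/census_sketch.lean`): at one
`δ ∈ (0, 1/2)` and one `U > 0`, eventually in even `L`, for some `κ > 0` per side, the ground-state
average of `Δ_d† Δ_d` over the sector ground eigenspace of `hubbardTorus 2 L 1 U + κ L⁻⁴ Δ_d† Δ_d`
is `≥ c L⁴` (trace form). `←` is the closer (Griffiths: a penalised ground-state average bounds
every unpenalised ground state from below); `→`: the summit's every-ground-state LRO at `(U, δ)` is
an eventual uniform floor `c L⁴` on every normalised sector ground state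
(`forall_hasLRO_iff_groundState_bound`), which re-dresses per side as the shifted average with
constant `c/4` (`exists_shiftedAverage_of_forall_groundState_bound`, first-order splitting at a
coupling below the gap). So the re-cut item is summit-equivalent. Griffiths (1964) §III; Kato
(1966) §II.5; Scalapino (1995) §2. [folklore] -/
theorem hubbardSuperconductivity_iff_shiftedAverage :
    _root_.HubbardSuperconductivity ↔
    (∃ δ ∈ Set.Ioo (0:ℝ) (1/2), ∃ U : ℝ, 0 < U ∧ ∃ c : ℝ, 0 < c ∧ ∃ L₀ : ℕ,
      ∀ (L : ℕ) [NeZero L], L₀ ≤ L → Even L → ∃ κ : ℝ, 0 < κ ∧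
      let N : ℕ := 2 * ⌊(1 - δ) * (L : ℝ) ^ 2 / 2⌋₊
      let H := hubbardTorus 2 L 1 U
      let S := szSector (Λ := FermionTorus 2 L) N 0
      let Yd : Matrix (Finset (Orb (FermionTorus 2 L))) (Finset (Orb (FermionTorus 2 L))) ℂ :=
        ((1 : ℂ) / (L : ℂ) ^ 4) • ((pairField dWaveFormFactor L)ᴴ * pairField dWaveFormFactor L)
      let E := S ⊓ Module.End.eigenspace (Matrix.toLin' (H + (κ : ℂ) • Yd))
        ((((H + (κ : ℂ) • Yd).minEnergyOn S : ℝ)) : ℂ)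
      let P := projMatrix (E.map (Fock.toEuclidean (ι := Orb (FermionTorus 2 L)) :
        Fock (Orb (FermionTorus 2 L)) →ₗ[ℂ] EuclideanSpace ℂ (Finset (Orb (FermionTorus 2 L)))))
      c * (L : ℝ) ^ 4 * P.trace.re ≤
        (P * ((pairField dWaveFormFactor L)ᴴ * pairField dWaveFormFactor L)).trace.re) := by
  refine ⟨fun h => ?_, hubbardSuperconductivity_of_shiftedAverage⟩
  obtain ⟨U, hU, δ, hδ, hLRO⟩ := HubbardSuperconductivity_iff.1 h
  obtain ⟨c, hc, L₀, hGS⟩ :=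
    (forall_hasLRO_iff_groundState_bound U δ (by linarith [hδ.1])).1 hLRO
  exact ⟨δ, hδ, U, hU, c / 4, by positivity, L₀, fun L _ hL hLe =>
    exists_shiftedAverage_of_forall_groundState_bound L U δ c hc (hGS L hL hLe)⟩

/-- **`HubbardSuperconductivity ↔ X'_th` — the engine-facing (finite-`β`, penalised-ensemble)
re-cut target is the summit, too.** The right-hand side is VERBATIM the hypothesis of the landed
closer `penalisedThermalAverageSummit` (= `BirPenalisedThermalLRO` of the census sketch): at one
`δ ∈ (0, 1/2)` and one `U > 0`, eventually in even `L`, for some `κ, β > 0` per side,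
`a + L² log 4 / (βκ) ≤ ⟨L⁻⁴ Δ_d† Δ_d⟩_{β,κ}` in the sector canonical ensemble of
`hubbardTorus 2 L 1 U + κ L⁻⁴ Δ_d† Δ_d`. `←` is the closer; `→` is
`forall_hasLRO_iff_groundState_bound` followed per side by
`exists_penalisedThermalAverage_of_forall_groundState_bound` (constant `c/16`). Simon (1993)
§II.13; Tasaki (2020) §2.2, App. A.2; Scalapino (1995) §2. [folklore] -/
theorem hubbardSuperconductivity_iff_penalisedThermalAverage :
    _root_.HubbardSuperconductivity ↔
    (∃ δ ∈ Set.Ioo (0:ℝ) (1/2), ∃ U : ℝ, 0 < U ∧ ∃ a : ℝ, 0 < a ∧ ∃ L₀ : ℕ,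
      ∀ (L : ℕ) [NeZero L], L₀ ≤ L → Even L → ∃ κ β : ℝ, 0 < κ ∧ 0 < β ∧
      let N : ℕ := 2 * ⌊(1 - δ) * (L : ℝ) ^ 2 / 2⌋₊
      let H := hubbardTorus 2 L 1 U
      let S := szSector (Λ := FermionTorus 2 L) N 0
      let PS := projMatrix (S.map (Fock.toEuclidean (ι := Orb (FermionTorus 2 L)) :
        Fock (Orb (FermionTorus 2 L)) →ₗ[ℂ] EuclideanSpace ℂ (Finset (Orb (FermionTorus 2 L)))))
      let Yd : Matrix (Finset (Orb (FermionTorus 2 L))) (Finset (Orb (FermionTorus 2 L))) ℂ :=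
        ((1 : ℂ) / (L : ℂ) ^ 4) • ((pairField dWaveFormFactor L)ᴴ * pairField dWaveFormFactor L)
      a + (L : ℝ) ^ 2 * Real.log 4 / (β * κ) ≤
        (PS * gibbsWeight β (H + (κ : ℂ) • Yd) * Yd).trace.re /
          (PS * gibbsWeight β (H + (κ : ℂ) • Yd)).trace.re) := by
  refine ⟨fun h => ?_, hubbardSuperconductivity_of_penalisedThermalAverage⟩
  obtain ⟨U, hU, δ, hδ, hLRO⟩ := HubbardSuperconductivity_iff.1 h
  obtain ⟨c, hc, L₀, hGS⟩ :=
    (forall_hasLRO_iff_groundState_bound U δ (by linarith [hδ.1])).1 hLRO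
  exact ⟨δ, hδ, U, hU, c / 16, by positivity, L₀, fun L _ hL hLe =>
    exists_penalisedThermalAverage_of_forall_groundState_bound L U δ c (by linarith [hδ.1]) hc
      (hGS L hL hLe)⟩

end Hubbard

/-! ## Route corollaries (plan-level certificates for item `stmt-HubbardSuperconductivity-2083`) -/

section Route

open Summit.HubbardSuperconductivity.HubbardSuperconductivity.Theses.BalabanIR

/-- **The re-cut target `X'_avg` is implied by the pair it replaces** (`BirGroundStateAverageLRO`,
rank 0, and crux 5 `BirEveryGroundState`): the pair gives the summit (`Assembly_holds`), and the
summit is `X'_avg` (`hubbardSuperconductivity_iff_shiftedAverage`). So re-cutting the route's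
target to `X'_avg` and dropping crux 5 loses nothing. [folklore] -/
theorem shiftedAverage_of_birGroundStateAverageLRO_of_birEveryGroundState :
    BirGroundStateAverageLRO → BirEveryGroundState →
    (∃ δ ∈ Set.Ioo (0:ℝ) (1/2), ∃ U : ℝ, 0 < U ∧ ∃ c : ℝ, 0 < c ∧ ∃ L₀ : ℕ,
      ∀ (L : ℕ) [NeZero L], L₀ ≤ L → Even L → ∃ κ : ℝ, 0 < κ ∧
      let N : ℕ := 2 * ⌊(1 - δ) * (L : ℝ) ^ 2 / 2⌋₊
      let H := hubbardTorus 2 L 1 U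
      let S := szSector (Λ := FermionTorus 2 L) N 0
      let Yd : Matrix (Finset (Orb (FermionTorus 2 L))) (Finset (Orb (FermionTorus 2 L))) ℂ :=
        ((1 : ℂ) / (L : ℂ) ^ 4) • ((pairField dWaveFormFactor L)ᴴ * pairField dWaveFormFactor L)
      let E := S ⊓ Module.End.eigenspace (Matrix.toLin' (H + (κ : ℂ) • Yd))
        ((((H + (κ : ℂ) • Yd).minEnergyOn S : ℝ)) : ℂ)
      let P := projMatrix (E.map (Fock.toEuclidean (ι := Orb (FermionTorus 2 L)) :
        Fock (Orb (FermionTorus 2 L)) →ₗ[ℂ] EuclideanSpace ℂ (Finset (Orb (FermionTorus 2 L)))))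
      c * (L : ℝ) ^ 4 * P.trace.re ≤
        (P * ((pairField dWaveFormFactor L)ᴴ * pairField dWaveFormFactor L)).trace.re) :=
  fun hA hE => hubbardSuperconductivity_iff_shiftedAverage.1 (Assembly_holds ⟨hA, hE⟩)

/-- **The thermal re-cut target `X'_th` is implied by the same pair** (`Assembly_holds`, then
`hubbardSuperconductivity_iff_penalisedThermalAverage`). [folklore] -/
theorem penalisedThermalAverage_of_birGroundStateAverageLRO_of_birEveryGroundState :
    BirGroundStateAverageLRO → BirEveryGroundState →
    (∃ δ ∈ Set.Ioo (0:ℝ) (1/2), ∃ U : ℝ, 0 < U ∧ ∃ a : ℝ, 0 < a ∧ ∃ L₀ : ℕ,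
      ∀ (L : ℕ) [NeZero L], L₀ ≤ L → Even L → ∃ κ β : ℝ, 0 < κ ∧ 0 < β ∧
      let N : ℕ := 2 * ⌊(1 - δ) * (L : ℝ) ^ 2 / 2⌋₊
      let H := hubbardTorus 2 L 1 U
      let S := szSector (Λ := FermionTorus 2 L) N 0
      let PS := projMatrix (S.map (Fock.toEuclidean (ι := Orb (FermionTorus 2 L)) :
        Fock (Orb (FermionTorus 2 L)) →ₗ[ℂ] EuclideanSpace ℂ (Finset (Orb (FermionTorus 2 L)))))
      let Yd : Matrix (Finset (Orb (FermionTorus 2 L))) (Finset (Orb (FermionTorus 2 L))) ℂ :=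
        ((1 : ℂ) / (L : ℂ) ^ 4) • ((pairField dWaveFormFactor L)ᴴ * pairField dWaveFormFactor L)
      a + (L : ℝ) ^ 2 * Real.log 4 / (β * κ) ≤
        (PS * gibbsWeight β (H + (κ : ℂ) • Yd) * Yd).trace.re /
          (PS * gibbsWeight β (H + (κ : ℂ) • Yd)).trace.re) :=
  fun hA hE => hubbardSuperconductivity_iff_penalisedThermalAverage.1 (Assembly_holds ⟨hA, hE⟩)

/-- **The re-typed reduction `4RS` (engine `2R` ⇒ coercivity `3` ⇒ `X'_avg`) is implied by the
present reduction `4R` together with crux 5**: under `2R` and `3`, `4R` gives the route's target on a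
window, crux 5 upgrades it at one coupling (`Theses.BalabanIR.closes`), and the summit is `X'_avg`.
So the census's re-cut route `{2R, 4RS}` is no harder than the present `{2R, 4R, 5}`; conversely
`4RS` closes the route alone with no crux 5, by the one-liner
`hubbardSuperconductivity_of_shiftedAverage (h4RS h2R h3)` (the census's `closes_recut`), and its
conclusion is summit-equivalent (`hubbardSuperconductivity_iff_shiftedAverage`). [folklore] -/
theorem birGappedPhaseReductionRS_of_reductionR_of_birEveryGroundState :
    BirGappedPhaseReductionR → BirEveryGroundState →
    (BirComplexStableXYR → BirBdGPhaseCoercivity →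
      ∃ δ ∈ Set.Ioo (0:ℝ) (1/2), ∃ U : ℝ, 0 < U ∧ ∃ c : ℝ, 0 < c ∧ ∃ L₀ : ℕ,
      ∀ (L : ℕ) [NeZero L], L₀ ≤ L → Even L → ∃ κ : ℝ, 0 < κ ∧
      let N : ℕ := 2 * ⌊(1 - δ) * (L : ℝ) ^ 2 / 2⌋₊
      let H := hubbardTorus 2 L 1 U
      let S := szSector (Λ := FermionTorus 2 L) N 0
      let Yd : Matrix (Finset (Orb (FermionTorus 2 L))) (Finset (Orb (FermionTorus 2 L))) ℂ :=
        ((1 : ℂ) / (L : ℂ) ^ 4) • ((pairField dWaveFormFactor L)ᴴ * pairField dWaveFormFactor L)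
      let E := S ⊓ Module.End.eigenspace (Matrix.toLin' (H + (κ : ℂ) • Yd))
        ((((H + (κ : ℂ) • Yd).minEnergyOn S : ℝ)) : ℂ)
      let P := projMatrix (E.map (Fock.toEuclidean (ι := Orb (FermionTorus 2 L)) :
        Fock (Orb (FermionTorus 2 L)) →ₗ[ℂ] EuclideanSpace ℂ (Finset (Orb (FermionTorus 2 L)))))
      c * (L : ℝ) ^ 4 * P.trace.re ≤
        (P * ((pairField dWaveFormFactor L)ᴴ * pairField dWaveFormFactor L)).trace.re) :=
  fun h4R h5 h2R h3 => hubbardSuperconductivity_iff_shiftedAverage.1 (closes h2R h3 h4R h5)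

end Route

end Summit.HubbardSuperconductivity.HubbardSuperconductivity.Theorems
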